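import Summits.CriticalPhenomena.Ising3DConformalLimit.Theses.HyperoctahedralRP
import Literature.Probability.LatticeModels.PointwiseScalingLimitScale
import Literature.Probability.LatticeModels.PointwiseScalingLimitEtaExists
import HarnessLib

/-!
# `ExistsScaleCovariantLimit` (item stmt-CriticalPhenomena-1981): `Δ` is an OUTPUT — unique,
in `[1/2, 3/4]`, equal to `(1 + η)/2`

Negative / structural knowledge about the crux
`Summit.CriticalPhenomena.Ising3DConformalLimit.Theses.HyperoctahedralRP.ExistsScaleCovariantLimit`,
standing crux disprover, cycle 2 (D-0016); THEOREM-ONLY. No rotation hypothesis anywhere.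

* `delta_mem_Icc_of_witness`: every witness `(ρ, Δ, S)` has `Δ ∈ [1/2, 3/4]` (tree
  `exists_rpow_scale_mem_Icc_threeQuarters`: infrared + Simon–Lieb bounds, and the cut at `3/4` from
  Duminil-Copin–Panis 2025 Thm 1.5 through the forced existence of `η`);
* REFUTED STRENGTHENINGS `not_crux_with_delta_gt_threeQuarters`, `not_crux_with_delta_lt_half`,
  `not_crux_with_planar_delta` (`Δ = 1/8`, the planar value);
* `delta_unique`: two witnesses — different `ρ`, different `S` — have the same `Δ` (limits are unique
  up to one scale), hence `crux_iff_existsUnique_delta`;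
* `eta_exists_of_crux`: the crux forces the lattice exponent `η ∈ [0, 1/2]` to exist (a `ρ`-, `Δ`-,
  `S`-free necessary condition), and `delta_eq_of_eta`: `Δ = (1 + η)/2`.

References: Duminil-Copin–Panis, CMP 406 (2025), Thm 1.5 [DuminilCopinPanis2025LowerBounds];
Di Francesco–Mathieu–Sénéchal 1997 §4.3.1 eq. (4.56) [FrancescoMathieuSenechal1997]; Simon 1980.
-/

noncomputable section

namespace Summit.CriticalPhenomena.Ising3DConformalLimit.ExistsScaleCovariantLimitNegative

open Literature.Probability.LatticeModels Filter Set
open scoped Topology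
open Summit.CriticalPhenomena.Ising3DConformalLimit.Theses

/-- Two scale exponents of a non-degenerate family on non-coincident pairs coincide
(evaluate at `(0,e₀)`, scale `2`). [folklore] -/
theorem delta_eq_of_two_scale_laws {S : CorrFamily 3} {Δ Δ' : ℝ} (hnd : IsNondegenerateTwoPoint S)
    (h : ∀ c : ℝ, 0 < c → ∀ x ∈ NonCoincident 3 2,
      S 2 (fun i => c • x i) = c ^ (-(2:ℝ) * Δ) * S 2 x)
    (h' : ∀ c : ℝ, 0 < c → ∀ x ∈ NonCoincident 3 2,
      S 2 (fun i => c • x i) = c ^ (-(2:ℝ) * Δ') * S 2 x) : Δ = Δ' := by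
  have hx := zero_unitVec_mem_nonCoincident (t := (1:ℝ)) one_ne_zero
  have ha := hnd _ hx
  have e₁ := h 2 two_pos _ hx
  have e₂ := h' 2 two_pos _ hx
  rw [e₁] at e₂
  have h2 := mul_right_cancel₀ ha.ne' e₂
  have hlog := congrArg Real.log h2
  rw [Real.log_rpow two_pos, Real.log_rpow two_pos] at hlog
  have hl : 0 < Real.log 2 := Real.log_pos one_lt_two
  have h3 := mul_right_cancel₀ hl.ne' hlog
  linarith

/-- **Every witness has `Δ ∈ [1/2, 3/4]`** (no rotation hypothesis).
[cite: DuminilCopinPanis2025LowerBounds, Theorem 1.5] -/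
theorem delta_mem_Icc_of_witness {ρ : ℝ → ℝ} {Δ : ℝ} {S : CorrFamily 3}
    (hρ : ∀ δ ∈ Set.Ioc (0:ℝ) 1, 0 < ρ δ) (hlim : HasPointwiseScalingLimit (criticalCorr 3) ρ S)
    (hnd : IsNondegenerateTwoPoint S) (hsc : IsScaleCovariant Δ S) : Δ ∈ Set.Icc (1/2 : ℝ) (3/4) := by
  obtain ⟨Δ', hΔ', hcov, -, -⟩ := hlim.exists_rpow_scale_mem_Icc_threeQuarters hρ hnd
  have hΔ : Δ = Δ' := delta_eq_of_two_scale_laws hnd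
    (fun c hc x _ => by exact_mod_cast hsc 2 c hc x) (fun c hc x hx => by exact_mod_cast hcov 2 c hc x hx)
  rw [hΔ]; exact hΔ'

/-- REFUTED STRENGTHENING: no witness of the crux has `3/4 < Δ`.
[cite: DuminilCopinPanis2025LowerBounds, Theorem 1.5] -/
theorem not_crux_with_delta_gt_threeQuarters :
    ¬ ∃ (ρ : ℝ → ℝ) (Δ : ℝ) (S : CorrFamily 3), ((∀ δ ∈ Set.Ioc (0:ℝ) 1, 0 < ρ δ) ∧ 0 < Δ ∧
      HasPointwiseScalingLimit (criticalCorr 3) ρ S ∧ (∀ n z, z ∉ NonCoincident 3 n → S n z = 0) ∧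
      IsNondegenerateTwoPoint S ∧ IsTranslationInvariant S ∧ IsScaleCovariant Δ S) ∧ 3/4 < Δ := by
  rintro ⟨ρ, Δ, S, ⟨hρ, -, hlim, -, hnd, -, hsc⟩, hΔ⟩
  exact absurd (delta_mem_Icc_of_witness hρ hlim hnd hsc).2 (not_le.2 hΔ)

/-- REFUTED STRENGTHENING: no witness has `Δ < 1/2` (Simon–Lieb). [cite: Simon1980, Thm. 1] -/
theorem not_crux_with_delta_lt_half :
    ¬ ∃ (ρ : ℝ → ℝ) (Δ : ℝ) (S : CorrFamily 3), ((∀ δ ∈ Set.Ioc (0:ℝ) 1, 0 < ρ δ) ∧ 0 < Δ ∧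
      HasPointwiseScalingLimit (criticalCorr 3) ρ S ∧ (∀ n z, z ∉ NonCoincident 3 n → S n z = 0) ∧
      IsNondegenerateTwoPoint S ∧ IsTranslationInvariant S ∧ IsScaleCovariant Δ S) ∧ Δ < 1/2 := by
  rintro ⟨ρ, Δ, S, ⟨hρ, -, hlim, -, hnd, -, hsc⟩, hΔ⟩
  exact absurd (delta_mem_Icc_of_witness hρ hlim hnd hsc).1 (not_le.2 hΔ)

/-- REFUTED STRENGTHENING: the planar value `Δ = 1/8` (Chelkak–Hongler–Izyurov 2015) is impossible on
`ℤ³`. [cite: ChelkakHonglerIzyurov2015, Thm 1.1] -/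
theorem not_crux_with_planar_delta :
    ¬ ∃ (ρ : ℝ → ℝ) (S : CorrFamily 3), (∀ δ ∈ Set.Ioc (0:ℝ) 1, 0 < ρ δ) ∧ (0:ℝ) < 1/8 ∧
      HasPointwiseScalingLimit (criticalCorr 3) ρ S ∧ (∀ n z, z ∉ NonCoincident 3 n → S n z = 0) ∧
      IsNondegenerateTwoPoint S ∧ IsTranslationInvariant S ∧ IsScaleCovariant (1/8) S := by
  rintro ⟨ρ, S, hρ, -, hlim, -, hnd, -, hsc⟩
  have h := (delta_mem_Icc_of_witness hρ hlim hnd hsc).1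
  norm_num at h

/-- **`Δ` is unique across ALL witnesses** (different `ρ`, different `S`): two non-degenerate limits
differ by `cⁿ` (`exists_scale_of_isNondegenerateTwoPoint`), so they have the same scale exponent.
[folklore] -/
theorem delta_unique {ρ ρ' : ℝ → ℝ} {Δ Δ' : ℝ} {S S' : CorrFamily 3}
    (hρ : ∀ δ ∈ Set.Ioc (0:ℝ) 1, 0 < ρ δ) (hlim : HasPointwiseScalingLimit (criticalCorr 3) ρ S)
    (hnd : IsNondegenerateTwoPoint S) (hsc : IsScaleCovariant Δ S)
    (hρ' : ∀ δ ∈ Set.Ioc (0:ℝ) 1, 0 < ρ' δ) (hlim' : HasPointwiseScalingLimit (criticalCorr 3) ρ' S')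
    (hnd' : IsNondegenerateTwoPoint S') (hsc' : IsScaleCovariant Δ' S') : Δ = Δ' := by
  obtain ⟨c, hc, hscale⟩ := hlim.exists_scale_of_isNondegenerateTwoPoint (by norm_num) hρ hρ' hlim' hnd hnd'
  refine delta_eq_of_two_scale_laws hnd (fun a ha x _ => by exact_mod_cast hsc 2 a ha x) ?_
  intro a ha x hx
  have hax : (fun i => a • x i) ∈ NonCoincident 3 2 := smul_mem_nonCoincident ha.ne' hx
  have e1 := hscale 2 _ hax
  have e2 := hscale 2 x hx
  have e3 : S' 2 (fun i => a • x i) = a ^ (-(2:ℝ) * Δ') * S' 2 x := by exact_mod_cast hsc' 2 a ha x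
  have hc2 : c ^ 2 ≠ 0 := pow_ne_zero 2 hc.ne'
  rw [e1, e2] at e3
  have e4 : c ^ 2 * S 2 (fun i => a • x i) = c ^ 2 * (a ^ (-(2:ℝ) * Δ') * S 2 x) := by
    rw [e3]; ring
  exact mul_left_cancel₀ hc2 e4

/-- The crux with `∃! Δ`. [folklore] -/
theorem crux_iff_existsUnique_delta :
    HyperoctahedralRP.ExistsScaleCovariantLimit ↔
      ∃! Δ : ℝ, ∃ (ρ : ℝ → ℝ) (S : CorrFamily 3), (∀ δ ∈ Set.Ioc (0:ℝ) 1, 0 < ρ δ) ∧ 0 < Δ ∧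
        HasPointwiseScalingLimit (criticalCorr 3) ρ S ∧ (∀ n z, z ∉ NonCoincident 3 n → S n z = 0) ∧
          IsNondegenerateTwoPoint S ∧ IsTranslationInvariant S ∧ IsScaleCovariant Δ S := by
  constructor
  · rintro ⟨ρ, Δ, S, h⟩
    refine ⟨Δ, ⟨ρ, S, h⟩, fun Δ' ⟨ρ', S', h'⟩ => ?_⟩
    exact delta_unique h'.1 h'.2.2.1 h'.2.2.2.2.1 h'.2.2.2.2.2.2 h.1 h.2.2.1 h.2.2.2.2.1 h.2.2.2.2.2.2
  · rintro ⟨Δ, ⟨ρ, S, h⟩, -⟩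
    exact ⟨ρ, Δ, S, h⟩

/-- **The crux forces `η` to exist**, `η ∈ [0, 1/2]` — a LATTICE statement free of `ρ`, `Δ`, `S`:
`log ⟨σ₀σ_y⟩_{β_c} / log ‖y‖ → −(1+η)`. Non-existence of `η` (an oscillating effective exponent) would
refute the crux. [cite: DuminilCopinPanis2025LowerBounds, Theorem 1.5] -/
theorem eta_exists_of_crux (h : HyperoctahedralRP.ExistsScaleCovariantLimit) :
    ∃ η ∈ Set.Icc (0:ℝ) (1/2), HasIsingExponentEta 3 η := by
  obtain ⟨ρ, Δ, S, hρ, -, hlim, -, hnd, -, -⟩ := h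
  exact hlim.exists_isingEta hρ hnd

/-- **`Δ = (1 + η)/2`** for every witness. [cite: FrancescoMathieuSenechal1997, §4.3.1 eq. (4.56)] -/
theorem delta_eq_of_eta {ρ : ℝ → ℝ} {Δ η : ℝ} {S : CorrFamily 3}
    (hρ : ∀ δ ∈ Set.Ioc (0:ℝ) 1, 0 < ρ δ) (hlim : HasPointwiseScalingLimit (criticalCorr 3) ρ S)
    (hnd : IsNondegenerateTwoPoint S) (hsc : IsScaleCovariant Δ S)
    (hη : HasIsingExponentEta 3 η) : Δ = (1 + η) / 2 := by
  obtain ⟨Δ', -, hcov, -, hη'⟩ := hlim.exists_rpow_scale_mem_Icc_threeQuarters hρ hnd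
  have hΔ : Δ = Δ' := delta_eq_of_two_scale_laws hnd
    (fun c hc x _ => by exact_mod_cast hsc 2 c hc x) (fun c hc x hx => by exact_mod_cast hcov 2 c hc x hx)
  have := HasIsingExponentEta.unique hη' hη
  rw [hΔ]; linarith

end Summit.CriticalPhenomena.Ising3DConformalLimit.ExistsScaleCovariantLimitNegative

end
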